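import Summits.ResolutionOfSingularities.ResolutionOfSingularities.Theorems.FrobeniusLadderFRationalResolutionRootAdjoinChart
import Mathlib.RingTheory.Polynomial.Quotient
import Mathlib.Algebra.CharP.Algebra
import Mathlib.Algebra.CharP.Lemmas
import Mathlib.Algebra.Polynomial.Degree.Domain
import HarnessLib

/-!
# Crux `FrobeniusLadder.FRationalResolution` (stmt-ResolutionOfSingularities-15317), line `redirect`,
# stub `stub_diagonalizableQuotientResolution` — item (F2b-core), LEMMA F of MEMO-15317-leafhand2-g21 §3: in the radicial fibre
# `F = κ[u]/(u^p − c)` the root is never congruent to a scalar modulo the square of a maximal ideal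

The remaining case of item (F2) (unit subgroup `B_𝔔 ≤ pA`, e.g. `pℤ/p² < ℤ/p²`) reduces (MEMO §3, projection step) the regularity of
the root-adjunction chart `S̃ = S[w]/(w^d − u)` at the point to a statement about the FIBRE `F = κ(𝔮)[u]/(u^p − c̄)` of the torsor
`Spec S^{(B)} → Spec S₀`: `ū ∉ κ + 𝔫²` for the maximal ideal `𝔫` of `F`. This file proves that statement, uniformly in the two cases
`c̄ ∉ κ^p` (`F` a field) and `c̄ = α^p` (`F = κ[π]/(π^p)`):

* ★ `root_sub_algebraMap_not_mem_sq` — `κ` a field of characteristic `p`, `c : κ`, `F = AdjoinRoot (X^p − C c)`, `𝔫` a maximal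
  ideal of `F`, `α : κ`: `ū − α ∉ 𝔫²`. Proof: `ū − α ∈ 𝔫` forces `c = α^p` (Frobenius), so `X^p − c = (X − α)^p`, the preimage of
  `𝔫` is `(X − α)`, and `ū − α ∈ 𝔫²` would give `(X − α)² ∣ (X − α)` modulo `(X − α)^p`, absurd for `p ≥ 2`.

Honest label: helper toward ONE leaf stub; no stub, crux or summit closed. No definitions, no named facts, no sorry.
[folklore; cite: Matsumura1987, §25]
-/

noncomputable section

-- single-problem summit: the doubled namespace component is forced
set_option linter.dupNamespace false

open Polynomial

namespace Summit.ResolutionOfSingularities.ResolutionOfSingularities.Theorems.FRationalResolution.RadicialFibreNotMemSq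

universe u

/-- ★ **LEMMA F.** `κ` a field of characteristic `p`, `c : κ`, `𝔫` a maximal ideal of `F = κ[u]/(u^p − c)`, `α : κ`: the element
`ū − α` is not in `𝔫²`. [folklore; cite: Matsumura1987, §25] -/
theorem root_sub_algebraMap_not_mem_sq {κ : Type u} [Field κ] (p : ℕ) [hp : Fact p.Prime] [CharP κ p] (c : κ)
    (𝔫 : Ideal (AdjoinRoot (X ^ p - C c : κ[X]))) [h𝔫 : 𝔫.IsMaximal] (α : κ) :
    AdjoinRoot.root (X ^ p - C c : κ[X]) - AdjoinRoot.of (X ^ p - C c : κ[X]) α ∉ 𝔫 ^ 2 := by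
  haveI : NeZero p := ⟨hp.out.ne_zero⟩
  haveI : CharP (AdjoinRoot (X ^ p - C c : κ[X])) p :=
    charP_of_injective_algebraMap (RootAdjoinChart.of_injective p c) p
  intro h
  have h1 : AdjoinRoot.root (X ^ p - C c : κ[X]) - AdjoinRoot.of (X ^ p - C c : κ[X]) α ∈ 𝔫 :=
    Ideal.pow_le_self two_ne_zero h
  -- `c = α^p`
  have hc : c = α ^ p := by
    by_contra hne
    have hmem : AdjoinRoot.of (X ^ p - C c : κ[X]) (c - α ^ p) ∈ 𝔫 := by
      have h2 := 𝔫.pow_mem_of_mem h1 p hp.out.pos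
      rw [sub_pow_char, RootAdjoinChart.root_pow_eq p c, ← map_pow, ← map_sub] at h2
      exact h2
    have hunit : IsUnit (AdjoinRoot.of (X ^ p - C c : κ[X]) (c - α ^ p)) := (Ne.isUnit (sub_ne_zero.2 hne)).map _
    exact h𝔫.ne_top (𝔫.eq_top_of_isUnit_mem hmem hunit)
  have hf : (X ^ p - C c : κ[X]) = (X - C α) ^ p := by rw [sub_pow_char, ← C_pow, hc]
  -- the preimage of `𝔫` in `κ[X]` is `(X − α)`
  haveI h𝔑 : (𝔫.comap (AdjoinRoot.mk (X ^ p - C c : κ[X]))).IsPrime := Ideal.IsPrime.comap _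
  have hXα : X - C α ∈ 𝔫.comap (AdjoinRoot.mk (X ^ p - C c : κ[X])) := by
    refine h𝔑.mem_of_pow_mem p ?_
    rw [← hf, Ideal.mem_comap, AdjoinRoot.mk_self]
    exact 𝔫.zero_mem
  have hmax : (Ideal.span {X - C α} : Ideal κ[X]).IsMaximal :=
    Ideal.Quotient.maximal_of_isField _
      (MulEquiv.isField (Field.toIsField κ) (Polynomial.quotientSpanXSubCAlgEquiv α).toMulEquiv)
  have h𝔑eq : Ideal.span {X - C α} = 𝔫.comap (AdjoinRoot.mk (X ^ p - C c : κ[X])) :=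
    hmax.eq_of_le h𝔑.ne_top ((Ideal.span_singleton_le_iff_mem _).2 hXα)
  -- push `h` back to `κ[X]`
  have h𝔫eq : 𝔫 = (𝔫.comap (AdjoinRoot.mk (X ^ p - C c : κ[X]))).map (AdjoinRoot.mk (X ^ p - C c : κ[X])) :=
    (Ideal.map_comap_of_surjective _ AdjoinRoot.mk_surjective 𝔫).symm
  have h3 : AdjoinRoot.mk (X ^ p - C c : κ[X]) (X - C α) ∈
      (Ideal.span {(X - C α) ^ 2} : Ideal κ[X]).map (AdjoinRoot.mk (X ^ p - C c : κ[X])) := by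
    rw [← Ideal.span_singleton_pow, h𝔑eq, Ideal.map_pow, ← h𝔫eq]
    have : AdjoinRoot.mk (X ^ p - C c : κ[X]) (X - C α) =
        AdjoinRoot.root (X ^ p - C c : κ[X]) - AdjoinRoot.of (X ^ p - C c : κ[X]) α := by
      rw [map_sub, AdjoinRoot.mk_X, AdjoinRoot.mk_C]
    rw [this]; exact h
  obtain ⟨q, hq, hqe⟩ := (Ideal.mem_map_iff_of_surjective _ AdjoinRoot.mk_surjective).1 h3
  -- `(X − α)² ∣ q`, `f ∣ q − (X − α)`, `(X − α)² ∣ f`: so `(X − α)² ∣ X − α`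
  obtain ⟨g, rfl⟩ := Ideal.mem_span_singleton.1 hq
  have hdvd1 : (X ^ p - C c : κ[X]) ∣ (X - C α) ^ 2 * g - (X - C α) := by
    rw [← AdjoinRoot.mk_eq_mk]; exact hqe
  have hdvd2 : (X - C α) ^ 2 ∣ (X ^ p - C c : κ[X]) := by
    rw [hf]; exact pow_dvd_pow _ hp.out.two_le
  have hdvd3 : (X - C α) ^ 2 ∣ (X - C α : κ[X]) :=
    (dvd_sub_right (dvd_mul_right ((X - C α) ^ 2) g)).1 (hdvd2.trans hdvd1)
  have hdeg := natDegree_le_of_dvd hdvd3 (X_sub_C_ne_zero α)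
  rw [(monic_X_sub_C α).natDegree_pow, natDegree_X_sub_C] at hdeg
  omega

end Summit.ResolutionOfSingularities.ResolutionOfSingularities.Theorems.FRationalResolution.RadicialFibreNotMemSq

end
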